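import Literature.NumberTheory.EllipticCurves.ModularParametrizationDegreeCongruenceProofs
import Literature.NumberTheory.EllipticCurves.CuspFormsGamma0IntegralBasisProofs
import Literature.NumberTheory.EllipticCurves.ModularParametrizationTrustBaseProofs
import HarnessLib

/-!
# The period lattice of a rational weight-`2` cusp form has rational invariants —
# unconditionally; the Eichler–Shimura cluster reduced to the congruence relation alone

Topic `NumberTheory/EllipticCurves`; a proofs-only file (theorems only: no definition, no named
fact, nothing restated; D-0026), written by the seat of the named fact
`IsNewformOf.exists_maninConstant_ne_zero` (`ModularParametrizationDegree.lean`;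
Breuil–Conrad–Diamond–Taylor 2001, p. 845, "(2) ⇒ (6) follows from a construction of Shimura
and a theorem of Faltings").

`PeriodLatticePresentationProofs.ratCast_g₂_g₃_periodLattice` proved: for a nonzero
`f ∈ S₂(Γ₀(N))` with rational Fourier coefficients whose period lattice `Λ_f` is a lattice
`Λ(L)`, the invariants `g₂(L), g₃(L)` are rational — **granted** Deligne–Serre 1974, (2.7.2)
(`DeligneSerre1974_span_integralLattice1 N k`, an unproved named fact) in the weights `k ≥ 12`,
used once: to conjugate by `σ ∈ Aut(ℂ)` the two `⟨d⟩`-fixed cusp forms `F, G ∈ S_k(Γ₁(N))`,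
`k = 12m`, of the presentation `℘_Λ(2πi∫f)·G = F`. Those forms come from `Γ₀(N)`, and for
`Γ₀(N)` the needed integral basis is now a theorem of the tree — Shimura 1971, Thm. 3.52 for
`Γ₀(N)`, `CuspFormsGamma0IntegralBasisProofs.exists_basis_int_cuspCoeff`, from the Hecke-stable
lattice `gamma0_exists_heckeStableLattice_holds` (Eichler–Shimura for `X₀(N)` in weight `2`,
Manin's weight-`k` M-symbols for even `k ≥ 4`) through Shimura's Thm. 3.48 and Thm. 3.51 — with
the corollary `exists_conj_cuspForm_of_forall_diamondOp_eq` (conjugates of `⟨d⟩`-fixed forms).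
Substituting it for `exists_cuspForm_conj` makes the rationality **unconditional**:

* `PeriodPair.ratCast_g₂_g₃_of_lattice_eq_periodLattice` — `g₂(L), g₃(L) ∈ ℚ` for `Λ(L) = Λ_f`,
  `f ≠ 0` with rational coefficients (no hypothesis beyond these), and
  `PeriodPair.ratCast_j_of_lattice_eq_periodLattice` — `j(Λ_f) ∈ ℚ`;
* `IsNewform0.exists_rat_g₂_g₃_of_lattice_eq_periodLattice` — for a newform with `K_f = ℚ`,
  `g₂(L) = -4a₄`, `g₃(L) = -4a₆` with `a₄, a₆ ∈ ℚ`: the rationality half (H-rat) of the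
  curve-free kernel `H` of `EichlerShimuraConstructionKernelProofs`, now a theorem;
* `IsNewform0.exists_shortModel_periodLattice` — **`E_f = ℂ/Λ_f` is an elliptic curve over `ℚ`
  with Néron-type lattice `Λ_f`** (Knapp 1993, Thm. 11.74 (d): "`Λ_f` is a lattice in `ℂ`, and
  `E` is isomorphic to `ℂ/Λ_f`"; Cremona 1997, §2.14: "Since `E_f` is defined over `ℚ`, the
  numbers `c₄` and `c₆` are rational"), obtained in the tree by the analytic route: `Λ_f` is a
  lattice (Shimura Thm. 7.14, `isZLattice_periodLattice_holds`), `x = ℘_Λ(2πi∫f)` is a quotient of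
  cusp forms, and `σ(g₂, g₃) = (g₂, g₃)` for every `σ ∈ Aut(ℂ/ℚ)` by transport of the Weierstrass
  differential equation.

Consequently the whole "(2) ⇒ (6)" cluster is reduced to the **Eichler–Shimura congruence
relation** for that one explicit curve, with no other analytic or arithmetic input left open on
the modular side (`…_of_congruenceRelation`, superseding the `…_of_congruence` theorems of
`ModularParametrizationDegreeCongruenceProofs`, which carried (2.7.2) as `hDS`):

* `rational_invariants_of_congruenceRelation` — the kernel `H` from (H-cong) alone;
* `eichlerShimuraConstruction_of_congruenceRelation` — `eichlerShimuraConstruction` from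
  modularity (`exists_isNewformOf`, for Carayol's part) and (H-cong);
* `strongWeil_of_congruenceRelation` — Knapp's Thm. 11.74 (d)–(e) with the rational Manin
  constant from (H-cong);
* `exists_maninConstant_ne_zero_of_congruenceRelation` — this seat's fact from (H-cong) at the
  primes `p ∤ N` and Faltings (`WeierstrassCurve.isIsogenous_iff_frobeniusTrace_eq`);
* `exists_maninConstant_ne_zero_of_congruenceRelation_cofinite` — the same from the congruence
  relation in Shimura's printed cofinite form (Thm. 7.15: "up to a finite number of Euler
  factors") and Faltings. **This is the trust base of `IsNewformOf.exists_maninConstant_ne_zero`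
  in the tree: Faltings' isogeny theorem and `a_p(ℂ/Λ_f) = a_p(f)` for almost all `p`.**

Why (H-cong) is not attempted: every printed proof reduces `X₀(N)` or `J₀(N)` modulo `p`
(Eichler 1954; Shimura 1958 and 1971, §7.2–7.4, Thm. 7.9; Igusa 1959; Deligne–Rapoport 1973;
B. Conrad's appendix to Agashe–Ribet–Stein 2006) — the modular curve as a curve over `ℚ` with good
reduction at `p ∤ N` and the moduli interpretation of `T_p` (Frobenius plus Verschiebung) — none
of which the tree has. Nothing is discharged; no statement of the tree is changed.

## References

* C. Breuil, B. Conrad, F. Diamond, R. Taylor, *On the modularity of elliptic curves over `ℚ`: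
  wild 3-adic exercises*, J. Amer. Math. Soc. 14 (2001), 843–939: Thm. A; p. 845, "(2) ⇒ (6)".
  [BCDTJAMS2001]
* G. Shimura, *Introduction to the arithmetic theory of automorphic functions*, 1971: Thm. 3.52
  (p. 86); Thm. 7.9, Thm. 7.14, Thm. 7.15 (PDF p. 212). [ShimuraIATAF1971] [Shimura1971]
* A. W. Knapp, *Elliptic Curves*, Math. Notes 40, Princeton 1993: Thm. 11.74 (d), (e) with the
  Remarks following it (PDF p. 287); Thm. 12.8 (PDF p. 301); PDF p. 302. [Knapp1993]
* J. E. Cremona, *Algorithms for Modular Elliptic Curves*, 2nd ed., CUP 1997: §2.8, §2.14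
  (pp. 33–34). [CremonaAlgorithms1997]
* P. Deligne, J.-P. Serre, *Formes modulaires de poids 1*, Ann. Sci. ÉNS 7 (1974): Prop. 2.7,
  (2.7.2). [DeligneSerreASENS1974]
* G. Faltings, *Endlichkeitssätze für abelsche Varietäten über Zahlkörpern*, Invent. Math. 73
  (1983): §5, Korollar 2. [Faltings1983Endlichkeit]
-/

noncomputable section

open Complex Filter Topology Set Function
open UpperHalfPlane hiding I
open scoped Real Topology Manifold MatrixGroups PeriodPair ModularForm Pointwise

open ModularForm SlashInvariantForm ModularFormClass PowerSeries

open Literature.NumberTheory.EllipticCurves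

namespace Literature.NumberTheory.EllipticCurves.ModularForms

open CongruenceSubgroup

variable {N : ℕ} [NeZero N]

/-! ### Rational invariants of the period lattice, unconditionally -/

/-- **The period lattice of a rational weight-`2` cusp form has rational invariants.** Let
`f ∈ S₂(Γ₀(N))`, `f ≠ 0`, have rational Fourier coefficients and let `L` be a period pair with
`Λ(L) = Λ_f` (`periodLattice f`). Then `g₂(L), g₃(L) ∈ ℚ`, i.e. `ℂ/Λ_f` is the elliptic curve
`y² = 4x³ − g₂x − g₃` over `ℚ` — the curve attached to `f` by Shimura's construction, obtained
from the analytic modular parametrisation `τ ↦ (℘_Λ(u), ℘_Λ'(u))` and descent along `Aut(ℂ)`.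
This is `ratCast_g₂_g₃_periodLattice` (`PeriodLatticePresentationProofs`) with its only
hypothesis, Deligne–Serre (2.7.2) in the weights `≥ 12`, removed: the conjugates `F^σ`, `G^σ` of
the `⟨d⟩`-fixed forms `F, G ∈ S_k(Γ₁(N))` of the presentation `℘_Λ(u)·G = F` are now supplied by
Shimura's Thm. 3.52 for `Γ₀(N)` (`exists_conj_cuspForm_of_forall_diamondOp_eq`,
`CuspFormsGamma0IntegralBasisProofs`, resting on the tree's Hecke-stable lattice
`gamma0_exists_heckeStableLattice_holds`); the rest of the argument is verbatim that of
`ratCast_g₂_g₃_periodLattice`. [cite: ShimuraIATAF1971, Thm. 7.14] [cite: Knapp1993, Thm. 11.74 (d)] -/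
theorem PeriodPair.ratCast_g₂_g₃_of_lattice_eq_periodLattice (f : CuspForm (Gamma0 N) 2)
    (hf : f ≠ 0) (hrat : ∀ n, ∃ q : ℚ, (q : ℂ) = cuspCoeff f n) (L : PeriodPair)
    (hL : ∀ x, x ∈ L.lattice ↔ x ∈ periodLattice f) :
    (∃ q : ℚ, (q : ℂ) = L.g₂) ∧ (∃ q : ℚ, (q : ℂ) = L.g₃) := by
  refine L.ratCast_g₂_g₃_of_forall_le fun σ M hM₂ hM₃ ↦ ?_
  obtain ⟨k, F, G, hk, hG0, hFd, hGd, hFG⟩ :=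
    exists_weierstrassP_eichlerIntegral_presentation_twelve_le f hf L fun x hx ↦ (hL x).mpr hx
  have hk2 : 2 ≤ k := by omega
  -- conjugate forms, from the integral basis of `S_k(Γ₀(N))` (Shimura Thm. 3.52)
  obtain ⟨F', hF'c₀, hF'd⟩ :=
    exists_conj_cuspForm_of_forall_diamondOp_eq hk2 (σ : ℂ →+* ℂ) F hFd
  obtain ⟨G', hG'c₀, hG'd⟩ :=
    exists_conj_cuspForm_of_forall_diamondOp_eq hk2 (σ : ℂ →+* ℂ) G hGd
  have hF'c : ∀ n, cuspCoeff F' n = σ (cuspCoeff F n) := fun n ↦ hF'c₀ n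
  have hG'c : ∀ n, cuspCoeff G' n = σ (cuspCoeff G n) := fun n ↦ hG'c₀ n
  have hG'0 : G' ≠ 0 := ne_zero_of_conj hG'c hG0
  have hF'1 := isCuspFunction_one_gamma1 F'
  have hG'1 := isCuspFunction_one_gamma1 G'
  -- the transported differential identity and the equation for `h = F'/G'`
  have hode0 := odeFun_eq_zero_of_presentation f hf L F G hFG
  have hode1 := odeFun_conj_eq_zero f hrat σ hF'c hG'c L.g₂ L.g₃ hode0
  rw [← hM₂, ← hM₃] at hode1
  set V : Set ℂ := {z : ℂ | 0 < z.im ∧ (⇑G' ∘ ofComplex) z ≠ 0} with hV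
  have hVo : IsOpen V := hG'1.differentiableOn_comp_ofComplex.continuousOn.isOpen_inter_preimage
    isOpen_upperHalfPlaneSet isOpen_compl_singleton
  have hVC : V ⊆ {z : ℂ | 0 < z.im} := fun z hz ↦ hz.1
  have hcount : ({z : ℂ | 0 < z.im} \ V).Countable := by
    refine (countable_zeros_cuspForm G' hG'0).mono ?_
    rintro z ⟨hz, hzV⟩
    exact ⟨hz, by by_contra h; exact hzV ⟨hz, h⟩⟩
  have hwan : AnalyticOnNhd ℂ (fun z : ℂ ↦ (⇑F' ∘ ofComplex) z / (⇑G' ∘ ofComplex) z) V :=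
    fun z hz ↦ (hF'1.analyticAt_comp_ofComplex hz.1).div (hG'1.analyticAt_comp_ofComplex hz.1) hz.2
  have hvan : AnalyticOnNhd ℂ (fun z : ℂ ↦ eichlerIntegral f (ofComplex z)) V :=
    fun z hz ↦ analyticAt_eichlerIntegral_comp_ofComplex f hz.1
  have hode : ∀ z ∈ V, deriv (fun w : ℂ ↦ (⇑F' ∘ ofComplex) w / (⇑G' ∘ ofComplex) w) z ^ 2 =
      deriv (fun w : ℂ ↦ eichlerIntegral f (ofComplex w)) z ^ 2 *
        (4 * ((⇑F' ∘ ofComplex) z / (⇑G' ∘ ofComplex) z) ^ 3 -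
          M.g₂ * ((⇑F' ∘ ofComplex) z / (⇑G' ∘ ofComplex) z) - M.g₃) :=
    fun z hz ↦ deriv_div_sq_of_odeFun_eq_zero f F' G' M.g₂ M.g₃ hode1 hz.1 hz.2
  obtain ⟨z₀, hz₀im, hz₀G, h0⟩ := exists_nondegenerate_of_conj f hf L σ hF'c hG'c hG0 hFG M.g₂ M.g₃
  -- the uniqueness theorem for the Weierstrass equation
  obtain ⟨ε, hε, c, -, hglob⟩ := M.exists_eq_weierstrassP_of_deriv_sq convex_setOf_im_pos
    isOpen_upperHalfPlaneSet hVo hVC hcount hwan hvan hode ⟨hz₀im, hz₀G⟩ h0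
  -- every period lies in `M`
  have hper : ∀ γ : Gamma0 N, cuspSymbol f γ ∈ M.lattice :=
    cuspSymbol_mem_of_eq_weierstrassP f hf M F' G' hF'd hG'd hG'0 hε
      (fun z hz hGz hc ↦ hglob z ⟨hz, hGz⟩ hc)
  have hsub : periodLattice f ≤ M.lattice.toAddSubgroup := by
    rw [periodLattice, AddSubgroup.closure_le]
    rintro _ ⟨γ, rfl⟩
    exact hper γ
  intro x hx
  exact hsub ((hL x).mp hx)

/-- **The `j`-invariant of `Λ_f` is rational**: for `f ∈ S₂(Γ₀(N))`, `f ≠ 0`, with rational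
Fourier coefficients and `Λ(L) = Λ_f`, `j(L) = 1728 g₂³/(g₂³ − 27g₃²) ∈ ℚ` (Cremona 1997, §2.14:
the curve `E_f` and its invariants are rational). [cite: CremonaAlgorithms1997, §2.14] -/
theorem PeriodPair.ratCast_j_of_lattice_eq_periodLattice (f : CuspForm (Gamma0 N) 2)
    (hf : f ≠ 0) (hrat : ∀ n, ∃ q : ℚ, (q : ℂ) = cuspCoeff f n) (L : PeriodPair)
    (hL : ∀ x, x ∈ L.lattice ↔ x ∈ periodLattice f) : ∃ q : ℚ, (q : ℂ) = L.j := by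
  obtain ⟨⟨q₂, h₂⟩, ⟨q₃, h₃⟩⟩ :=
    PeriodPair.ratCast_g₂_g₃_of_lattice_eq_periodLattice f hf hrat L hL
  refine ⟨1728 * q₂ ^ 3 / (q₂ ^ 3 - 27 * q₃ ^ 2), ?_⟩
  rw [PeriodPair.j_def, ← h₂, ← h₃]
  push_cast
  rfl

/-- **Newform version, in the shape of the Eichler–Shimura kernel — unconditionally.** For a
newform `f ∈ S₂(Γ₀(N))` with coefficient field `ℚ` and a period pair `L` spanning `Λ_f` there
are `a₄, a₆ ∈ ℚ` with `g₂(L) = −4a₄`, `g₃(L) = −4a₆`: the torus `ℂ/Λ_f` is the elliptic curve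
`y² = x³ + a₄x + a₆` over `ℚ` with Néron-type lattice `Λ_f` (Knapp 1993, Thm. 11.74 (d);
Cremona 1997, §2.14: "since `E_f` is defined over `ℚ`, the numbers `c₄` and `c₆` are rational").
This is the rationality half (H-rat) of the kernel `H` of `EichlerShimuraConstructionKernelProofs`,
now a theorem with no hypothesis. [cite: Knapp1993, Thm. 11.74 (d)] [cite: CremonaAlgorithms1997, §2.14] -/
theorem IsNewform0.exists_rat_g₂_g₃_of_lattice_eq_periodLattice {f : CuspForm (Gamma0 N) 2}
    (hf : IsNewform0 f) (hQ : coeffField f = ⊥) (L : PeriodPair)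
    (hL : L.lattice.toAddSubgroup = periodLattice f) :
    ∃ a₄ a₆ : ℚ, L.g₂ = -4 * (a₄ : ℂ) ∧ L.g₃ = -4 * (a₆ : ℂ) := by
  have hL' : ∀ x, x ∈ L.lattice ↔ x ∈ periodLattice f := fun x ↦ by
    rw [← hL]
    rfl
  obtain ⟨⟨q₂, h₂⟩, ⟨q₃, h₃⟩⟩ := PeriodPair.ratCast_g₂_g₃_of_lattice_eq_periodLattice f hf.ne_zero
    (fun n ↦ exists_ratCast_eq_coeff_of_coeffField_eq_bot hQ n) L hL'
  refine ⟨-q₂ / 4, -q₃ / 4, ?_, ?_⟩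
  · rw [← h₂]; push_cast; ring
  · rw [← h₃]; push_cast; ring

/-- **`E_f = ℂ/Λ_f` is an elliptic curve over `ℚ`** (Knapp 1993, Thm. 11.74 (d); Cremona 1997,
§2.14), in existential form: for a newform `f ∈ S₂(Γ₀(N))` with `K_f = ℚ` there are a period pair
`L_f` spanning `Λ_f` (Shimura 1971, Thm. 7.14: `Λ_f` is a lattice,
`IsNewform0.exists_periodPair_of_coeffField_eq_bot`) and `a₄, a₆ ∈ ℚ` such that the elliptic curve
`y² = x³ + a₄x + a₆` over `ℚ` has `L_f` as a Néron-type period pair (`g₂(L_f) = c₄/12`,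
`g₃(L_f) = c₆/216`: the pull-back of `dx/2y` along `ℂ → ℂ/Λ_f ≅ E(ℂ)` is `dz`).
[cite: Knapp1993, Thm. 11.74 (d)] [cite: CremonaAlgorithms1997, §2.14] [cite: ShimuraIATAF1971, Thm. 7.14] -/
theorem IsNewform0.exists_shortModel_periodLattice {f : CuspForm (Gamma0 N) 2}
    (hf : IsNewform0 f) (hQ : coeffField f = ⊥) :
    ∃ (Lf : PeriodPair) (a₄ a₆ : ℚ), Lf.lattice.toAddSubgroup = periodLattice f ∧
      ({ a₁ := 0, a₂ := 0, a₃ := 0, a₄ := a₄, a₆ := a₆ } : WeierstrassCurve ℚ).IsElliptic ∧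
        IsNeronLatticeOf
          (({ a₁ := 0, a₂ := 0, a₃ := 0, a₄ := a₄, a₆ := a₆ } : WeierstrassCurve ℚ).baseChange ℂ)
          Lf := by
  obtain ⟨Lf, hLf⟩ := hf.exists_periodPair_of_coeffField_eq_bot hQ
  obtain ⟨a₄, a₆, h₂, h₃⟩ := hf.exists_rat_g₂_g₃_of_lattice_eq_periodLattice hQ Lf hLf
  exact ⟨Lf, a₄, a₆, hLf, isElliptic_shortModel h₂ h₃, isNeronLatticeOf_shortModel h₂ h₃⟩

/-! ### The Eichler–Shimura cluster from the congruence relation alone -/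

/-- **The curve-free kernel `H` from the Eichler–Shimura congruence relation alone.** Hypothesis
`hC`: for every newform `f ∈ S₂(Γ₀(N))` with `K_f = ℚ`, every period pair `L` spanning `Λ_f` and
all `a₄, a₆ ∈ ℚ` with `g₂(L) = -4a₄`, `g₃(L) = -4a₆`, the curve `y² = x³ + a₄x + a₆` has
`a_p = a_p(f)` for the primes `p ∤ N` (Knapp 1993, Thm. 11.74 (e) with the Remark on Igusa, for
the model of `ℂ/Λ_f` with differential `dz`). Conclusion: the kernel `H` of
`EichlerShimuraConstructionKernelProofs` (`rational_invariants_of_congruence` with (H-rat) now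
unconditional, `IsNewform0.exists_rat_g₂_g₃_of_lattice_eq_periodLattice`).
[cite: Knapp1993, Thm. 11.74 (d), (e) with Remarks (PDF p. 287)] -/
theorem rational_invariants_of_congruenceRelation
    (hC : ∀ (N : ℕ) [NeZero N] (f : CuspForm (Gamma0 N) 2), IsNewform0 f → coeffField f = ⊥ →
      ∀ (L : PeriodPair), L.lattice.toAddSubgroup = periodLattice f →
        ∀ a₄ a₆ : ℚ, L.g₂ = -4 * (a₄ : ℂ) → L.g₃ = -4 * (a₆ : ℂ) →
          ∀ p : ℕ, p.Prime → ¬ p ∣ N →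
            (qExpansion 1 ⇑f).coeff p =
              (({ a₁ := 0, a₂ := 0, a₃ := 0, a₄ := a₄, a₆ := a₆ } : WeierstrassCurve ℚ).LFunction
                p : ℂ))
    (N : ℕ) [NeZero N] (f : CuspForm (Gamma0 N) 2) (hf : IsNewform0 f) (hQ : coeffField f = ⊥)
    (L : PeriodPair) (hL : L.lattice.toAddSubgroup = periodLattice f) :
    ∃ a₄ a₆ : ℚ, L.g₂ = -4 * (a₄ : ℂ) ∧ L.g₃ = -4 * (a₆ : ℂ) ∧
      ∀ p : ℕ, p.Prime → ¬ p ∣ N →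
        (qExpansion 1 ⇑f).coeff p =
          (({ a₁ := 0, a₂ := 0, a₃ := 0, a₄ := a₄, a₆ := a₆ } : WeierstrassCurve ℚ).LFunction p
            : ℂ) := by
  obtain ⟨a₄, a₆, h₂, h₃⟩ := hf.exists_rat_g₂_g₃_of_lattice_eq_periodLattice hQ L hL
  exact ⟨a₄, a₆, h₂, h₃, hC N f hf hQ L hL a₄ a₆ h₂ h₃⟩

/-- **`eichlerShimuraConstruction` from modularity and the congruence relation** (modularity,
`exists_isNewformOf`, only for Carayol's part `aₙ(f) = aₙ(E)` for *all* `n`). The open content of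
the named fact `eichlerShimuraConstruction` beyond modularity is thereby exactly the congruence
relation `hC` for the one explicit curve `y² = x³ - (g₂(Λ_f)/4)x - g₃(Λ_f)/4`.
[cite: Knapp1993, Thm. 11.74 with Remarks (PDF p. 287) and Thm. 12.8 (PDF p. 301)] -/
theorem eichlerShimuraConstruction_of_congruenceRelation (h₁ : exists_isNewformOf)
    (hC : ∀ (N : ℕ) [NeZero N] (f : CuspForm (Gamma0 N) 2), IsNewform0 f → coeffField f = ⊥ →
      ∀ (L : PeriodPair), L.lattice.toAddSubgroup = periodLattice f →
        ∀ a₄ a₆ : ℚ, L.g₂ = -4 * (a₄ : ℂ) → L.g₃ = -4 * (a₆ : ℂ) →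
          ∀ p : ℕ, p.Prime → ¬ p ∣ N →
            (qExpansion 1 ⇑f).coeff p =
              (({ a₁ := 0, a₂ := 0, a₃ := 0, a₄ := a₄, a₆ := a₆ } : WeierstrassCurve ℚ).LFunction
                p : ℂ)) :
    eichlerShimuraConstruction :=
  eichlerShimuraConstruction_of_rational_invariants h₁ (rational_invariants_of_congruenceRelation hC)

/-- **Knapp's Thm. 11.74 (d)–(e) with the rational Manin constant, from the congruence relation
alone**: for every rational newform an elliptic `W/ℚ` with `a_p(W) = a_p(f)` for `p ∤ N` and a
Néron-type period pair `L` of `W` with `Λ_L = c • Λ_f`, `c ∈ ℚˣ` (here `c = 1`).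
[cite: Knapp1993, Thm. 11.74 (d), (e) with Remarks (PDF p. 287) and PDF p. 302] -/
theorem strongWeil_of_congruenceRelation
    (hC : ∀ (N : ℕ) [NeZero N] (f : CuspForm (Gamma0 N) 2), IsNewform0 f → coeffField f = ⊥ →
      ∀ (L : PeriodPair), L.lattice.toAddSubgroup = periodLattice f →
        ∀ a₄ a₆ : ℚ, L.g₂ = -4 * (a₄ : ℂ) → L.g₃ = -4 * (a₆ : ℂ) →
          ∀ p : ℕ, p.Prime → ¬ p ∣ N →
            (qExpansion 1 ⇑f).coeff p =
              (({ a₁ := 0, a₂ := 0, a₃ := 0, a₄ := a₄, a₆ := a₆ } : WeierstrassCurve ℚ).LFunction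
                p : ℂ))
    (N : ℕ) [NeZero N] (f : CuspForm (Gamma0 N) 2) (hf : IsNewform0 f) (hQ : coeffField f = ⊥) :
    ∃ W : WeierstrassCurve ℚ, W.IsElliptic ∧
      (∀ p : ℕ, p.Prime → ¬ p ∣ N → (qExpansion 1 ⇑f).coeff p = (W.LFunction p : ℂ)) ∧
        ∃ (L : PeriodPair) (c : ℚ), IsNeronLatticeOf (W.baseChange ℂ) L ∧ c ≠ 0 ∧
          (L.lattice : Set ℂ) = (c : ℂ) • (periodLattice f : Set ℂ) :=
  strongWeil_of_rational_invariants (rational_invariants_of_congruenceRelation hC) N f hf hQ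

/-- **`IsNewformOf.exists_maninConstant_ne_zero` from the congruence relation at `p ∤ N` and
Faltings' isogeny theorem** — "(2) ⇒ (6) follows from a construction of Shimura and a theorem of
Faltings" (Breuil–Conrad–Diamond–Taylor 2001, p. 845), with Shimura's construction carried out
in the tree up to the congruence relation. [cite: BCDTJAMS2001, p. 845, "(2) ⇒ (6)"]
[cite: Knapp1993, Thm. 11.74 (e) with Remarks (PDF p. 287)] -/
theorem exists_maninConstant_ne_zero_of_congruenceRelation
    (hC : ∀ (N : ℕ) [NeZero N] (f : CuspForm (Gamma0 N) 2), IsNewform0 f → coeffField f = ⊥ →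
      ∀ (L : PeriodPair), L.lattice.toAddSubgroup = periodLattice f →
        ∀ a₄ a₆ : ℚ, L.g₂ = -4 * (a₄ : ℂ) → L.g₃ = -4 * (a₆ : ℂ) →
          ∀ p : ℕ, p.Prime → ¬ p ∣ N →
            (qExpansion 1 ⇑f).coeff p =
              (({ a₁ := 0, a₂ := 0, a₃ := 0, a₄ := a₄, a₆ := a₆ } : WeierstrassCurve ℚ).LFunction
                p : ℂ))
    (hF : WeierstrassCurve.isIsogenous_iff_frobeniusTrace_eq) :
    IsNewformOf.exists_maninConstant_ne_zero :=
  exists_maninConstant_ne_zero_of_rational_invariants (rational_invariants_of_congruenceRelation hC)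
    hF

/-- **One newform at a time: `c Λ_f ⊆ Λ_W` from the cofinite congruence relation for `ℂ/Λ_f`
and Faltings.** Let `f ∈ S₂(Γ₀(N))` be the newform of the elliptic curve `W/ℚ` (`IsNewformOf W f`)
and `L` a Néron-type period pair of `W`. Suppose that for every period pair `L_f` spanning `Λ_f`
and all `a₄, a₆ ∈ ℚ` with `(g₂(L_f), g₃(L_f)) = (-4a₄, -4a₆)` the curve `y² = x³ + a₄x + a₆` has
`a_p = a_p(f)` for all but finitely many primes `p` (Shimura 1971, Thm. 7.15, for this `f`). Then,
granted Faltings' isogeny theorem, `a Λ_f ⊆ Λ_L` for an integer `a ≠ 0`. Proof: `K_f = ℚ`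
(`IsNewformOf.coeffField_eq_bot_of_isNewformOf`); a period pair `L_f` spans `Λ_f`
(`IsNewform0.exists_periodPair_of_coeffField_eq_bot`, Shimura Thm. 7.14); `a₄, a₆ ∈ ℚ` exist
(`IsNewform0.exists_rat_g₂_g₃_of_lattice_eq_periodLattice`, unconditional); the short model `E`
is elliptic with Néron-type lattice `Λ_f` (`isElliptic_shortModel`, `isNeronLatticeOf_shortModel`);
`a_p(E) = a_p(f) = a_p(W)` off a finite set, so `E ~ W` over `ℚ`
(`WeierstrassCurve.isIsogenous_of_finite_setOf_LFunction_ne`, Faltings); and `ℚ`-isogenous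
curves have commensurable Néron lattices (`neronLattice_commensurable_of_isIsogenous_holds`).
[cite: BCDTJAMS2001, p. 845, "(2) ⇒ (6)"] [cite: ShimuraIATAF1971, Thm. 7.14 and Thm. 7.15 (PDF p. 212)]
[cite: Faltings1983Endlichkeit, §5 Korollar 2 (i) ⟺ (iii)] -/
theorem IsNewformOf.exists_int_mul_mem_of_congruenceRelation_cofinite
    (hF : WeierstrassCurve.isIsogenous_iff_frobeniusTrace_eq) {W : WeierstrassCurve ℚ}
    [W.IsElliptic] {f : CuspForm (Gamma0 N) 2} (hf : IsNewformOf W f)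
    (hC : ∀ (Lf : PeriodPair), Lf.lattice.toAddSubgroup = periodLattice f →
      ∀ a₄ a₆ : ℚ, Lf.g₂ = -4 * (a₄ : ℂ) → Lf.g₃ = -4 * (a₆ : ℂ) →
        {p : ℕ | p.Prime ∧ (qExpansion 1 ⇑f).coeff p ≠
          (({ a₁ := 0, a₂ := 0, a₃ := 0, a₄ := a₄, a₆ := a₆ } : WeierstrassCurve ℚ).LFunction
            p : ℂ)}.Finite)
    {L : PeriodPair} (hL : IsNeronLatticeOf (W.baseChange ℂ) L) :
    ∃ c : ℤ, c ≠ 0 ∧ ∀ z ∈ periodLattice f, (c : ℂ) * z ∈ L.lattice := by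
  have hQ : coeffField f = ⊥ := hf.coeffField_eq_bot_of_isNewformOf
  obtain ⟨Lf, hLf⟩ := hf.1.exists_periodPair_of_coeffField_eq_bot hQ
  obtain ⟨a₄, a₆, h₂, h₃⟩ := hf.1.exists_rat_g₂_g₃_of_lattice_eq_periodLattice hQ Lf hLf
  haveI := isElliptic_shortModel h₂ h₃
  have hiso : WeierstrassCurve.IsIsogenous
      ({ a₁ := 0, a₂ := 0, a₃ := 0, a₄ := a₄, a₆ := a₆ } : WeierstrassCurve ℚ) W := by
    refine WeierstrassCurve.isIsogenous_of_finite_setOf_LFunction_ne hF _ W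
      ((hC Lf hLf a₄ a₆ h₂ h₃).subset ?_)
    rintro p ⟨hp, hne⟩
    refine ⟨hp, fun h ↦ hne ?_⟩
    have h' := h.symm.trans (hf.2 p)
    exact_mod_cast h'
  obtain ⟨a, ha0, ha⟩ :=
    neronLattice_commensurable_of_isIsogenous_holds hiso (isNeronLatticeOf_shortModel h₂ h₃) hL
  refine ⟨a, ha0, fun z hz ↦ ha z ?_⟩
  rw [← hLf] at hz
  exact hz

/-- **`IsNewformOf.exists_maninConstant_ne_zero` from the *cofinite* congruence relation and
Faltings** — the sharpest reduction: beyond the named fact `isIsogenous_iff_frobeniusTrace_eq`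
(Faltings 1983, §5 Kor. 2), a discharge must supply exactly Shimura's Thm. 7.15 for the model
`y² = x³ + a₄x + a₆`, `(-4a₄, -4a₆) = (g₂(L), g₃(L))`, of `ℂ/Λ_f`: `a_p(f) = a_p(ℂ/Λ_f)` for all
but finitely many primes `p` ("coincides, up to a finite number of Euler factors, with" `L(s, f)`)
— level by level, `IsNewformOf.exists_int_mul_mem_of_congruenceRelation_cofinite`.
[cite: BCDTJAMS2001, p. 845, "(2) ⇒ (6)"] [cite: ShimuraIATAF1971, Thm. 7.14 and Thm. 7.15 (PDF p. 212)]
[cite: Faltings1983Endlichkeit, §5 Korollar 2 (i) ⟺ (iii)] -/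
theorem exists_maninConstant_ne_zero_of_congruenceRelation_cofinite
    (hC : ∀ (N : ℕ) [NeZero N] (f : CuspForm (Gamma0 N) 2), IsNewform0 f → coeffField f = ⊥ →
      ∀ (L : PeriodPair), L.lattice.toAddSubgroup = periodLattice f →
        ∀ a₄ a₆ : ℚ, L.g₂ = -4 * (a₄ : ℂ) → L.g₃ = -4 * (a₆ : ℂ) →
          {p : ℕ | p.Prime ∧ (qExpansion 1 ⇑f).coeff p ≠
            (({ a₁ := 0, a₂ := 0, a₃ := 0, a₄ := a₄, a₆ := a₆ } : WeierstrassCurve ℚ).LFunction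
              p : ℂ)}.Finite)
    (hF : WeierstrassCurve.isIsogenous_iff_frobeniusTrace_eq) :
    IsNewformOf.exists_maninConstant_ne_zero := by
  intro W _ N _ f hf L hL
  exact hf.exists_int_mul_mem_of_congruenceRelation_cofinite hF
    (hC N f hf.1 hf.coeffField_eq_bot_of_isNewformOf) hL

/-- **BCDT's (6) — `nonempty_modularParametrizationData`, the target fact of `ModularCurve.lean`
— from modularity, the congruence relation and Faltings**: by
`nonempty_modularParametrizationData_of_exists_isNewformOf` (`ModularParametrizationTrustBaseProofs`:
(6) ⇔ (2) ∧ `IsNewformOf.exists_maninConstant_ne_zero`) and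
`exists_maninConstant_ne_zero_of_congruenceRelation`. So the open content of (6) beyond the named
facts `exists_isNewformOf` (Breuil–Conrad–Diamond–Taylor 2001, Thm. A) and
`isIsogenous_iff_frobeniusTrace_eq` (Faltings) is exactly the congruence relation `hC`.
[cite: BCDTJAMS2001, Thm. A with p. 845, (2) ⇒ (6)] -/
theorem nonempty_modularParametrizationData_of_congruenceRelation (h₁ : exists_isNewformOf)
    (hC : ∀ (N : ℕ) [NeZero N] (f : CuspForm (Gamma0 N) 2), IsNewform0 f → coeffField f = ⊥ →
      ∀ (L : PeriodPair), L.lattice.toAddSubgroup = periodLattice f →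
        ∀ a₄ a₆ : ℚ, L.g₂ = -4 * (a₄ : ℂ) → L.g₃ = -4 * (a₆ : ℂ) →
          ∀ p : ℕ, p.Prime → ¬ p ∣ N →
            (qExpansion 1 ⇑f).coeff p =
              (({ a₁ := 0, a₂ := 0, a₃ := 0, a₄ := a₄, a₆ := a₆ } : WeierstrassCurve ℚ).LFunction
                p : ℂ))
    (hF : WeierstrassCurve.isIsogenous_iff_frobeniusTrace_eq) :
    nonempty_modularParametrizationData :=
  nonempty_modularParametrizationData_of_exists_isNewformOf h₁
    (exists_maninConstant_ne_zero_of_congruenceRelation hC hF)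

end Literature.NumberTheory.EllipticCurves.ModularForms

end
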